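import Summits.FinalStateConjecture.FinalStateConjecture.Theses.SwallowTheDatum
import Summits.FinalStateConjecture.FinalStateConjecture.Theorems.SwallowTheDatumKerrShieldedDataExistStubCapProfile
import Summits.FinalStateConjecture.FinalStateConjecture.Theorems.SwallowTheDatumKerrShieldedDataExistStubCapImmersion
import Summits.FinalStateConjecture.FinalStateConjecture.Theorems.SwallowTheDatumKerrShieldedDataExistStubCapGlue
import Summits.FinalStateConjecture.FinalStateConjecture.Theorems.SwallowTheDatumKerrShieldedDataExistStubCapShield
import Summits.FinalStateConjecture.FinalStateConjecture.Theorems.SwallowTheDatumKerrShieldedDataExistStubCapFarH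
import Summits.FinalStateConjecture.FinalStateConjecture.Theorems.SwallowTheDatumKerrShieldedDataExistStubCapFarK
import Summits.FinalStateConjecture.FinalStateConjecture.Theorems.SwallowTheDatumKerrShieldedDataExistStubIsotropicEnd
import Literature.Geometry.Lorentzian.InteriorKerrGluing
import Literature.Geometry.Lorentzian.AsymptoticallyFlatCompleteness
import Literature.Geometry.Lorentzian.FinalState
import HarnessLib

/-!
# Route SwallowTheDatum — crux `KerrShieldedDataExist` (stmt-FinalStateConjecture-10055) from ONE exact
# Kerr-cylinder pocket ("KerrCap", line `plug-the-second-sheet` v4)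

Lead prover-line-stmt-FinalStateConjecture-10055-c1-0, 2026-08-16. This file makes the reshaped line's REDUCTION
durable. The crux `Summit.FinalStateConjecture.FinalStateConjecture.Theses.SwallowTheDatum.KerrShieldedDataExist` — one
admissible vacuum datum on `E3` which, outside a compact set, IS the hard-coded bent Kerr–Schild/Boyer–Lindquist leaf
`t* = T_{M,a}(r)` of a sub-extremal Kerr(`M, a`) down to a junction radius `r₁ ∈ (r₋, r₊)` — FOLLOWS from the single
hypothesis

  ExactPocket: there is a smooth datum `D'` on `E3`, solving the vacuum constraints on a ball `{‖y‖ < ρ₂}`, which on a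
  collar `{σ₂ < ‖y‖ < ρ₂}` (`1 ≤ σ₂`) is EXACTLY the datum induced by Kerr(`M, a`), `|a| < M`, on its spacelike
  cylinder `{r = r₀}` INSIDE THE BLACK HOLE (`r₋ < r₀ < r₊`), in standard position
  (`LiMei.IsKerrCylinderOn M a r₀ τ₀ id`).

ExactPocket is Li–Mei's collapse pocket made exact: the near-Schwarzschild pocket of J. Li, H. Mei, CMP 378 (2020) =
arXiv:2005.01249, Thm 2.1 + §2.2 (named fact `LiMei.nearSchwarzschildPocket`, `Literature/…/LiMeiCollapsePocket.lean`)
fed into their PRINTED interior Kerr gluing Prop 4.1 = Thm 2.2 (named fact `LiMei.interiorKerrGluing`,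
`Literature/…/InteriorKerrGluing.lean`); see `…ExactPocketOfLiMei.lean` for that (conditional) step.

Everything else is PROVED in the tree, for every sub-extremal spin (no Einstein evolution anywhere): the cap PROFILES
(`stub_capProfile`: cylinder zone, corner inside the black hole, pinned graph zone with smooth inverse, quasi-isotropic
Boyer–Lindquist far zone), the CAP MAP `Ψ(u) = (τ(s), L_{ϱ(s)} Rot_z(α(s)) u/s)` as a smooth spacelike immersion into the
ingoing Kerr–Schild chart with a smooth future unit normal (`stub_capImmersion`: conormal `ϱ′dt* − τ′dr`), the GLUING of
the pocket to its induced vacuum data (`stub_capGlue`, through `Kerr.ricci_smoothMetric` and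
`Assembly.exists_initialDataSet_of_localData`), the SHIELDING BLOCK of the crux (`stub_capShield`: end chart
`φ = ϱ⁻¹(r) · Rot_z(−α) ℓ⃗`, time-translation and reparametrisation invariance of the induced data), and the
Dafermos–Rodnianski END (`stub_capFarH`: `h = (Σ/s²)δ + a²(r²+2Mr+a²μ²)/(Σs⁴) ω⊗ω`, `h − (1+2M/s)δ ∈ O₂(s⁻²)`;
`stub_capFarK`: `k = −(m/2) 𝓛_b h ∈ O₁(s⁻³)` by the Killing shortcut), plus completeness of a sole DR end
(`isComplete_of_isSoleEnd_holds`).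
-/

set_option linter.dupNamespace false

noncomputable section

open Set Function Filter Topology TopologicalSpace
open scoped Manifold ContDiff Topology InnerProductSpace
open Literature.Geometry.Lorentzian
open Summit.FinalStateConjecture.FinalStateConjecture.Theorems.KerrShieldedDataExist

namespace Summit.FinalStateConjecture.FinalStateConjecture.Theorems.SwallowTheDatum

/-- Dafermos–Rodnianski strong asymptotic flatness on an end from symbol estimates `O₂(r⁻²)` of the metric defect
and `O₁(r⁻³)` of `k` (both one order better than required: `O(r^{−2−m}) = o(r^{−1−m})`,
`O(r^{−3−m}) = o(r^{−2−m})`). Dafermos–Rodnianski arXiv:0811.0354, App. B.2.3. [cite: DafermosRodnianski2013, App. B.2.3] -/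
theorem KerrCap.isStronglyAsymptoticallyFlatDR_of_isBigOSmooth (e : AFEnd E3) (D : InitialDataSet (𝓡 3) E3) (M : ℝ)
    (hh : IsBigOSmooth 2 (-2) fun y : E3 ↦
      AFEnd.hCoeff e D y - (1 + 2 * M / ‖y‖) • (innerSL ℝ : E3 →L[ℝ] E3 →L[ℝ] ℝ))
    (hk : IsBigOSmooth 1 (-3) (AFEnd.kCoeff e D)) :
    e.IsStronglyAsymptoticallyFlatDR D M := by
  refine ⟨fun m hm ↦ ?_, fun m hm ↦ ?_⟩
  · exact (hh.isBigO hm).trans_isLittleO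
      (isLittleO_norm_rpow_rpow_cobounded_of_lt (E := E3) (p := -2 - (m : ℝ)) (q := -1 - (m : ℝ)) (by linarith))
  · exact (hk.isBigO hm).trans_isLittleO (isLittleO_norm_rpow_rpow_cobounded_of_lt (E := E3) (by linarith))

/-- **The crux `KerrShieldedDataExist` from ONE exact Kerr-cylinder pocket** (the composition of line
`plug-the-second-sheet` v4 = KerrCap, all of whose geometric obligations are theorems of the tree): given a smooth datum
`D'` on `E3`, vacuum on a ball `{‖y‖ < ρ₂}` and exactly the standard Kerr(`M, a`)-cylinder datum `{r = r₀}`,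
`r₋ < r₀ < r₊`, on a collar `{σ₂ < ‖y‖ < ρ₂}`, `1 ≤ σ₂`, there is an admissible vacuum datum on `E3` satisfying the
crux's shielding block (with these `(M, a)`, junction radius `r₁ = (r₀ + r₊)/2`-type, the literal bent height, the
pinned graph and its future unit normal). Logical shape: profiles (cylinder zone up to `ρ₂`) → cap map (membership by
the radius identity) → immersion + normal → glue → shield block; far stubs → Dafermos–Rodnianski end on the
tautological chart beyond `σ₅` → sole end, completeness → `admissibleVacuumData` → the crux decl by name.
[cite: LiMei2020, §2.2] [cite: Christodoulou1999, p. A24] [cite: DafermosRodnianski2013, App. B.2.3] -/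
theorem kerrShieldedDataExist_of_exactPocket :
    (∀ [Kerr.Facts], ∃ (M a r₀ τ₀ σ₂ ρ₂ : ℝ) (D' : InitialDataSet (𝓡 3) E3),
      |a| < M ∧ Kerr.rMinus M a < r₀ ∧ r₀ < Kerr.rPlus M a ∧ 1 ≤ σ₂ ∧ σ₂ < ρ₂ ∧
      LiMei.IsVacuumOn {y : E3 | ‖y‖ < ρ₂} D' ∧
      LiMei.IsKerrCylinderOn M a r₀ τ₀ LinearIsometry.id {y : E3 | σ₂ < ‖y‖ ∧ ‖y‖ < ρ₂} D') →
    Summit.FinalStateConjecture.FinalStateConjecture.Theses.SwallowTheDatum.KerrShieldedDataExist := by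
  intro h0 inst
  obtain ⟨M, a, r₀, τ₀, σ₂, ρ₂, D', ha, hr₀m, hr₀p, hσ₂, hσρ, hvac', hcyl⟩ := @h0 inst
  have hM0 : 0 < M := (abs_nonneg a).trans_lt ha
  have hM : 0 ≤ M := hM0.le
  have hrm0 : 0 ≤ Kerr.rMinus M a := Kerr.IsSubextremal.rMinus_nonneg ha
  have hr₀ : 0 < r₀ := hrm0.trans_lt hr₀m
  -- the profiles, with cylinder zone up to `σ₃ := ρ₂`
  obtain ⟨τ, ϱ, α, ϱinv, σ₄, σ₅, c, rb, h34, h45, hrb0, hrbp, hτs, hϱs, hαs, hcylz, hϱge, hτ', hϱ', hsum,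
    hle, hgraph, hinv1, hinv2, hinvs, hfar, h8⟩ :=
    stub_capProfile M a r₀ τ₀ ρ₂ ha hr₀m hr₀p (hσ₂.trans hσρ.le)
  -- chart radius `rc := r₀/2`, immersion domain `{‖u‖ > σ}`, `σ := (σ₂ + ρ₂)/2`
  set rc : ℝ := r₀ / 2 with hrc
  have hrc0 : 0 ≤ rc := by rw [hrc]; positivity
  have hrcr : rc < r₀ := by rw [hrc]; linarith
  set σ : ℝ := (σ₂ + ρ₂) / 2 with hσdef
  have hσ2 : σ₂ < σ := by rw [hσdef]; linarith
  have hσρ' : σ < ρ₂ := by rw [hσdef]; linarith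
  have hσ0 : 0 < σ := by linarith
  have hσ4 : σ < σ₄ := by linarith
  -- the cap map
  set X : E3 → E3 := fun u ↦
    !₂[(ϱ ‖u‖ * (Real.cos (α ‖u‖) * u 0 - Real.sin (α ‖u‖) * u 1) -
          a * (Real.sin (α ‖u‖) * u 0 + Real.cos (α ‖u‖) * u 1)) / ‖u‖,
       (ϱ ‖u‖ * (Real.sin (α ‖u‖) * u 0 + Real.cos (α ‖u‖) * u 1) +
          a * (Real.cos (α ‖u‖) * u 0 - Real.sin (α ‖u‖) * u 1)) / ‖u‖,
       ϱ ‖u‖ * u 2 / ‖u‖] with hXdef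
  have hX : ∀ u : E3, X u =
      !₂[(ϱ ‖u‖ * (Real.cos (α ‖u‖) * u 0 - Real.sin (α ‖u‖) * u 1) -
            a * (Real.sin (α ‖u‖) * u 0 + Real.cos (α ‖u‖) * u 1)) / ‖u‖,
         (ϱ ‖u‖ * (Real.sin (α ‖u‖) * u 0 + Real.cos (α ‖u‖) * u 1) +
            a * (Real.cos (α ‖u‖) * u 0 - Real.sin (α ‖u‖) * u 1)) / ‖u‖,
         ϱ ‖u‖ * u 2 / ‖u‖] := fun u ↦ rfl
  obtain ⟨hrad, himm⟩ := stub_capImmersion M a r₀ σ σ₄ c rb rc hM τ ϱ α X ha hr₀m hrbp hrc0 hrcr hσ0 hτs hϱs hαs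
    hϱge hτ' hϱ' hsum hle hgraph hX
  let Ω : Opens E3 := ⟨{u : E3 | σ < ‖u‖}, isOpen_lt continuous_const continuous_norm⟩
  have hΩ : (Ω : Set E3) = {u : E3 | σ < ‖u‖} := rfl
  have hmem : ∀ u : Ω, E4.ofTimeSpace (τ ‖(u : E3)‖) (X u) ∈ Kerr.region a rc := by
    intro u
    have hu : σ < ‖(u : E3)‖ := u.2
    have hu0 : (u : E3) ≠ 0 := by
      intro h0
      rw [h0, norm_zero] at hu
      linarith
    rw [Kerr.mem_region, hrad _ _ hu0]
    exact max_lt (by linarith [hϱge ‖(u : E3)‖]) (by linarith [hϱge ‖(u : E3)‖])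
  let Ψ : Ω → Kerr.region a rc := fun u ↦ ⟨E4.ofTimeSpace (τ ‖(u : E3)‖) (X u), hmem u⟩
  have hΨ : ∀ u : Ω, (Ψ u : E4) = E4.ofTimeSpace (τ ‖(u : E3)‖) (X u) := fun u ↦ rfl
  obtain ⟨hsp, N, hNs, hN⟩ := himm Ω Ψ hΩ hΨ
  -- glue the pocket to the induced data of the cap map
  obtain ⟨C, hCvac, hCh, hCk⟩ := stub_capGlue M a r₀ τ₀ σ₂ σ ρ₂ rc hM D' τ ϱ α X Ω Ψ N ha hr₀m hr₀p hrc0 hrcr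
    hσ₂ hσ2 hσρ' hvac' hcyl (fun s hs ↦ hcylz s hs) hX hΩ hΨ hsp hNs hN
  -- the shielding block
  obtain hblock := stub_capShield M a σ σ₄ c rb rc hM τ ϱ α ϱinv X Ω Ψ N C ha (hr₀m.trans hrb0) hrbp hrc0
    (by linarith) hσ0 hσ4 hτs hϱs hαs hgraph hinv1 hinv2 hinvs hX hΩ hΨ hsp hNs hN hCh hCk
  -- the far end: tautological chart beyond `σ₅`
  have hσ₅ : 0 < σ₅ := by linarith
  let e : AFEnd E3 := ⟨exteriorRegion σ₅, σ₅, hσ₅, Diffeomorph.refl (𝓡 3) (exteriorRegion σ₅) ∞,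
    fun R' hR' ↦ isClosed_image_val_preimage_refl hR'⟩
  have hsole : e.IsSoleEnd := isSoleEnd_of_chart_id e (fun _ ↦ rfl) (fun _ h ↦ h)
  have hfarz : ∀ s, σ₅ ≤ s → τ s = Negative.bentHeight M a (ϱ s) + c ∧
      ϱ s = s + M + (M ^ 2 - a ^ 2) / (4 * s) ∧
      α s = a / (Kerr.rPlus M a - Kerr.rMinus M a) *
        Real.log ((ϱ s - Kerr.rPlus M a) / (ϱ s - Kerr.rMinus M a)) := fun s hs ↦
    ⟨(hgraph s (by linarith)).1, (hfar s hs).1, (hfar s hs).2⟩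
  have hσσ₅ : σ < σ₅ := by linarith
  have hmemΩ : ∀ u : Ω, σ₅ < ‖(u : E3)‖ → e.R < ‖(u : E3)‖ := fun u hu ↦ hu
  have hH := stub_capFarH M a c σ σ₅ rc τ ϱ α X Ω Ψ (AFEnd.hCoeff e C) ha hrc0 hσ0 hσσ₅ hτs hϱs hαs hfarz h8 hX
    hΩ hΨ (fun u hu v w ↦ by
      rw [hCoeff_apply_of_dataChart_eq e (fun _ ↦ rfl) C (hmemΩ u hu) v w, hCh u v w])
  have hK := stub_capFarK M a c σ σ₅ rc hM τ ϱ α X Ω Ψ N (AFEnd.kCoeff e C) ha hrc0 hσ0 hσσ₅ hτs hϱs hαs hfarz h8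
    hX hΩ hΨ hN hNs (fun u hu v w ↦ by
      rw [kCoeff_apply_of_dataChart_eq e (fun _ ↦ rfl) C (hmemΩ u hu) v w, hCk u v w])
  have hDR : e.IsStronglyAsymptoticallyFlatDR C M :=
    KerrCap.isStronglyAsymptoticallyFlatDR_of_isBigOSmooth e C M hH hK
  have hadm : C ∈ admissibleVacuumData E3 := by
    refine mem_admissibleVacuumData_iff.mpr ⟨?_, e, M, hsole, hDR⟩
    intro hLC
    exact ⟨hCvac, isComplete_of_isSoleEnd_holds E3 C e M 1 2 2 1 zero_le_one hDR hsole⟩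
  exact ⟨C, hadm, M, hblock⟩

end Summit.FinalStateConjecture.FinalStateConjecture.Theorems.SwallowTheDatum

end
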